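import Literature.Geometry.Lorentzian.KerrPhotonShellSphericalOrbits
import HarnessLib

/-!
# The Giorgi–Klainerman–Szeftel trapping region `{|𝒯| ≤ r³/10}` contains the Kerr photon shell
# exactly up to `|a| ≈ 0.2472 M` (kernel-certified threshold)

(family `gr`; namespace `Literature.Geometry.Lorentzian.Kerr`; built on
`KerrPhotonShellSphericalOrbits.lean` / `KerrNullRadialPotential.lean`: the signed photon radii
`r_ph⁺ = photonOrbitRadius M (−|a|) ∈ (M, 3M]` (prograde), `r_ph⁻ = photonOrbitRadius M |a| ∈ [3M, 4M]`
(retrograde), the photon-orbit cubic `p(c) = c(c − 3M)² − 4Ma²`, `p ≤ 0` on the shell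
`[r_ph⁺, r_ph⁻]` and `p(r_ph^±) = 0`.)

Giorgi–Klainerman–Szeftel, *Wave equations estimates and the nonlinear stability of slowly rotating
Kerr black holes* (arXiv:2205.14808 = Pure Appl. Math. Q. 2024), Definition 1.4.2 = Definition 6.1.9,
define the **trapping region** of their spacetime by the purely radial condition
`𝓜_trap := 𝓜 ∩ {|𝒯|/r³ ≤ δ_trap}`, `δ_trap = 1/10`, `𝒯 := r³ − 3mr² + a²r + ma²`, and state:
"This is the region that contains all trapped null geodesics, for sufficiently small `a/m`."
(In exact Kerr the trapped null geodesics are the orbits asymptotic to Teo's spherical photon orbits,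
whose radii fill the photon shell `[r̂₁, r̂₂] = [r_ph⁺, r_ph⁻]`, GKS Remark 3.8.5; E. Teo, Gen. Rel.
Grav. 35 (2003).) The cubic `𝒯` is the numerator of Teo's impact parameter
`λ(c) = −𝒯(c)/(a(c − M))` of the spherical photon orbit of radius `c` (`Kerr.sphericalImpact`), so
`{𝒯 = 0}` is the radius of the zero-angular-momentum spherical photon orbit; `𝓜_trap` is a radial
collar around it. The smallness of `a/m` in this clause is never quantified in the source. This file
**quantifies it** (real algebra only, no geodesic theory beyond the cited shell lemmas):

* `Kerr.abs_gksTrapping_le_of_mem_photonShell`: for `0 < M` and **`|a| ≤ 0.2472·M`**, every radius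
  `c` of the photon shell satisfies `|𝒯(c)| ≤ c³/10`, i.e. the whole shell lies in `{|𝒯|/r³ ≤ 1/10}`;
* `Kerr.gksTrapping_photonOrbitRadius_neg_lt`: for **`0.2473·M ≤ |a| ≤ 0.99·M`** the prograde
  circular photon orbit radius `r_ph⁺` has `𝒯(r_ph⁺) < −(r_ph⁺)³/10`, i.e. a trapped null geodesic
  (the prograde equatorial circular photon orbit) lies OUTSIDE `{|𝒯|/r³ ≤ 1/10}`.

Hence the largest `λ` such that the clause of Definition 1.4.2 holds for all `|a| ≤ λM` lies in
`(0.2472, 0.2473)`; it is the algebraic number `λ⋆ = ½√(c⋆(c⋆ − 3)²) = 0.2472007…` where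
`c⋆ = 2.6990647…` is the root in `(2, 3)` of `5c³ − 3c² − 45c + 45` (the prograde orbit exits the
collar first, through `𝒯 = −r³/10`; the retrograde orbit exits through `𝒯 = +r³/10` only at
`|a|/M = 0.27308…`). On the photon orbits `4Ma² = c(c − 3M)²`, and then
`𝒯(c) + c³/10 = c(5c³ − 3Mc² − 45M²c + 45M³)/(20M)` — this identity (`gksTrapping_add_on_orbit`)
is the whole computation. Beyond `λ⋆` the energy–Morawetz multipliers of GKS Part II, which are
exactly Killing only on `𝓜_trap` (GKS §6.1–6.3, vectorfield `T̂_δ`), no longer see all of trapping;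
this is one of the places where the hypothesis `|a|/m ≪ 1` of the Klainerman–Szeftel theorem enters
(census of the `|a| ≪ M` dependence, Final-State-Conjecture literature audit). Nothing here asserts
anything about the validity of the GKS estimates; the file records a threshold implicit in a
published definition.

## References
* E. Giorgi, S. Klainerman, J. Szeftel, arXiv:2205.14808; Pure Appl. Math. Q. (2024),
  doi:10.4310/pamq.241128023033 — Def. 1.4.2 (p. 36), Def. 6.1.9 (p. 215), Remark 3.8.5 (p. 145)
  (key `GiorgiKlainermanSzeftel2022`).
* E. Teo, *Spherical photon orbits around a Kerr black hole*, Gen. Rel. Grav. 35 (2003) 1909–1926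
  (key `Teo2003`); J. M. Bardeen, W. H. Press, S. A. Teukolsky, ApJ 178 (1972) 347, (2.18)
  (key `BardeenPressTeukolsky1972`).
-/

noncomputable section

namespace Literature.Geometry.Lorentzian

namespace Kerr

/-- The **Giorgi–Klainerman–Szeftel trapping cubic** `𝒯(r) = r³ − 3Mr² + a²r + Ma²` of Kerr with
mass `M` and specific angular momentum `a` (GKS write `m` for the mass); their trapping region is
`{|𝒯|/r³ ≤ 1/10}`. [cite: GiorgiKlainermanSzeftel2022, Def. 1.4.2 and Def. 6.1.9] -/
def gksTrapping (M a r : ℝ) : ℝ :=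
  r ^ 3 - 3 * M * r ^ 2 + a ^ 2 * r + M * a ^ 2

/-- Unfolding lemma for `gksTrapping`. [cite: GiorgiKlainermanSzeftel2022, Def. 1.4.2] -/
theorem gksTrapping_def (M a r : ℝ) :
    gksTrapping M a r = r ^ 3 - 3 * M * r ^ 2 + a ^ 2 * r + M * a ^ 2 := rfl

/-- `𝒯` is even in `a`. [cite: GiorgiKlainermanSzeftel2022, Def. 1.4.2] -/
theorem gksTrapping_neg (M a r : ℝ) : gksTrapping M (-a) r = gksTrapping M a r := by
  simp [gksTrapping]

/-- At `a = 0` the cubic is `r²(r − 3M)`: the GKS collar is centred at the Schwarzschild photon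
sphere `r = 3M`. [cite: GiorgiKlainermanSzeftel2022, Def. 1.4.2] -/
theorem gksTrapping_zero (M r : ℝ) : gksTrapping M 0 r = r ^ 2 * (r - 3 * M) := by
  simp [gksTrapping]; ring

/-- **`𝒯` is the numerator of Teo's impact parameter**: for `a ≠ 0`, `c ≠ M`,
`sphericalImpact M a c = −𝒯(c)/(a(c − M))` (Teo 2003, eq. (8)); so `𝒯(c) = 0` exactly at the radius
of the zero-angular-momentum spherical photon orbit. [cite: Teo2003, eq. (8)] -/
theorem sphericalImpact_eq_neg_gksTrapping_div (M a c : ℝ) :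
    sphericalImpact M a c = -gksTrapping M a c / (a * (c - M)) := by
  simp [sphericalImpact, gksTrapping]; ring

/-- Homogeneity: `𝒯(M, Mα, Mx) = M³ 𝒯(1, α, x)`. [folklore] -/
theorem gksTrapping_scale (M α x : ℝ) :
    gksTrapping M (M * α) (M * x) = M ^ 3 * gksTrapping 1 α x := by
  simp [gksTrapping]; ring

/-- **The key identity**: on a radius `c` with `4Ma² = c(c − 3M)²` (a circular/spherical photon orbit
radius of the equatorial type, `p(c) = 0`), `20M(𝒯(c) + c³/10) = c(5c³ − 3Mc² − 45M²c + 45M³)`.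
[folklore] -/
theorem gksTrapping_add_on_orbit {M a c : ℝ} (h : c * (c - 3 * M) ^ 2 = 4 * M * a ^ 2) :
    20 * M * (gksTrapping M a c + c ^ 3 / 10) =
      c * (5 * c ^ 3 - 3 * M * c ^ 2 - 45 * M ^ 2 * c + 45 * M ^ 3) := by
  simp only [gksTrapping]
  linear_combination (-5 * (c + M)) * h

/-! ### Normalised real algebra (`M = 1`, `α = a/M`, `x = r/M`) -/

/-- The cubic `5x³ − 3x² − 45x + 45` is non-negative for `x ≥ 2.699065` (its largest root is
`c⋆ = 2.69906474…`). [folklore] -/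
theorem exitCubic_nonneg {x : ℝ} (hx : (539813 : ℝ) / 200000 ≤ x) :
    0 ≤ 5 * x ^ 3 - 3 * x ^ 2 - 45 * x + 45 := by
  have h0 : 0 ≤ x - 539813 / 200000 := by linarith
  have h2 : 0 ≤ (x - 539813 / 200000) ^ 2 := sq_nonneg _
  have h3 : 0 ≤ (x - 539813 / 200000) ^ 3 := pow_nonneg h0 3
  nlinarith [h0, h2, h3]

/-- The cubic `5x³ − 3x² − 45x + 45` is negative on `[1.07, 2.699062]` (strictly between its roots
`1.0566…` and `2.69906…`). [folklore] -/
theorem exitCubic_neg {x : ℝ} (h₁ : (107 : ℝ) / 100 ≤ x) (h₂ : x ≤ (1349531 : ℝ) / 500000) :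
    5 * x ^ 3 - 3 * x ^ 2 - 45 * x + 45 < 0 := by
  -- with `x₁ = 1349531/500000`: `5x³ − 3x² − 45x + 45 = (x − x₁) Q(x) + v`,
  -- `Q(x) = 5x² + (5x₁ − 3)x + (5x₁² − 3x₁ − 45) > 0` on `[1.07, x₁]` and `v < 0`.
  have hQ : 0 < 5 * x ^ 2 + (5 * (1349531 / 500000 : ℝ) - 3) * x
      + (5 * (1349531 / 500000 : ℝ) ^ 2 - 3 * (1349531 / 500000) - 45) := by
    nlinarith [mul_nonneg (by linarith : (0 : ℝ) ≤ x - 107 / 100)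
      (by linarith : (0 : ℝ) ≤ 5 * (x + 107 / 100) + 5 * (1349531 / 500000) - 3)]
  nlinarith [mul_nonneg (by linarith : (0 : ℝ) ≤ 1349531 / 500000 - x) hQ.le]

/-- `x(x − 3)²` is antitone on `[1, 3]` (difference form). [folklore] -/
theorem orbitFun_le_of_le {x y : ℝ} (h1 : 1 ≤ x) (hxy : x ≤ y) (hy : y ≤ 3) :
    y * (y - 3) ^ 2 ≤ x * (x - 3) ^ 2 := by
  -- `x(x−3)² − y(y−3)² = (y − x)(3u + 3w − u² − uw − w²)`, `u = 3 − x`, `w = 3 − y`, and on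
  -- `0 ≤ w ≤ u ≤ 2`: `u² ≤ 2u`, `w² ≤ 2w`, `uw ≤ 2w`, remainder `(y − x)(u − w) = (y − x)²`.
  have hyx : (0 : ℝ) ≤ y - x := by linarith
  have h3x : (0 : ℝ) ≤ 3 - x := by linarith
  have hx1 : (0 : ℝ) ≤ x - 1 := by linarith
  have h3y : (0 : ℝ) ≤ 3 - y := by linarith
  have hy1 : (0 : ℝ) ≤ y - 1 := by linarith
  nlinarith [mul_nonneg (mul_nonneg hyx h3x) hx1, mul_nonneg (mul_nonneg hyx h3y) hy1,
    mul_nonneg (mul_nonneg hyx h3y) hx1, sq_nonneg (y - x)]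

/-- Normalised **lower containment**: if `x ≥ 2.699065` and `x(x − 3)² ≤ 4α²` then
`𝒯(1, α, x) ≥ −x³/10`. [folklore] -/
theorem neg_le_gksTrapping_one {α x : ℝ} (hx : (539813 : ℝ) / 200000 ≤ x)
    (hshell : x * (x - 3) ^ 2 ≤ 4 * α ^ 2) :
    -(x ^ 3 / 10) ≤ gksTrapping 1 α x := by
  have hc := exitCubic_nonneg hx
  have h1 : x * (x - 3) ^ 2 * (x + 1) ≤ 4 * α ^ 2 * (x + 1) :=
    mul_le_mul_of_nonneg_right hshell (by linarith)
  have h2 : 0 ≤ x * (5 * x ^ 3 - 3 * x ^ 2 - 45 * x + 45) := mul_nonneg (by linarith) hc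
  simp only [gksTrapping]
  nlinarith [h1, h2]

/-- Normalised **upper containment**: if `α² ≤ 0.2472²`, `1 ≤ x` and `x(x − 3)² ≤ 4α²` then
`𝒯(1, α, x) ≤ x³/10` (the shell bound forces `x ≤ 3.2855`; the retrograde orbit would exit only at
`α = 0.27308…`). [folklore] -/
theorem gksTrapping_one_le {α x : ℝ} (hα : α ^ 2 ≤ ((2472 : ℝ) / 10000) ^ 2) (h1 : 1 ≤ x)
    (hshell : x * (x - 3) ^ 2 ≤ 4 * α ^ 2) :
    gksTrapping 1 α x ≤ x ^ 3 / 10 := by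
  simp only [gksTrapping]
  have hαx : α ^ 2 * (x + 1) ≤ ((2472 : ℝ) / 10000) ^ 2 * (x + 1) :=
    mul_le_mul_of_nonneg_right hα (by linarith)
  rcases le_or_gt x 3 with hx3 | hx3
  · -- `0.9x³ − 3x² ≤ x²(2.7 − 3) = −0.3x² ≤ −0.3(2x − 1)`, while `α²(x + 1) ≤ 0.0612 (x + 1)`
    nlinarith [mul_nonneg (by linarith : (0 : ℝ) ≤ 3 - x) (sq_nonneg x),
      mul_nonneg (by linarith : (0 : ℝ) ≤ x - 1) (by linarith : (0 : ℝ) ≤ x - 1), hαx]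
  · -- `x > 3`: `3(x − 3)² ≤ x(x − 3)² ≤ 4α² ≤ 4·0.2472²`, so `x − 3 ≤ 0.2855`
    have h3 : (0 : ℝ) ≤ x - 3 := by linarith
    have hsq : (x - 3) ^ 2 ≤ (2855 / 10000 : ℝ) ^ 2 := by
      nlinarith [mul_nonneg h3 (sq_nonneg (x - 3))]
    have hx' : x - 3 ≤ 2855 / 10000 :=
      (pow_le_pow_iff_left₀ h3 (by norm_num) two_ne_zero).mp hsq
    nlinarith [mul_nonneg (sq_nonneg x) (by linarith : (0 : ℝ) ≤ 2855 / 10000 - (x - 3)),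
      mul_nonneg h3 (by linarith : (0 : ℝ) ≤ x + 3), hαx]

/-- Normalised **exit of the prograde orbit**: if `0.2473² ≤ α² ≤ 0.99²`, `1 < x ≤ 3` and
`x(x − 3)² = 4α²` (so `x = r_ph⁺/M`) then `𝒯(1, α, x) < −x³/10`. [folklore] -/
theorem gksTrapping_one_lt_neg {α x : ℝ} (hα : ((2473 : ℝ) / 10000) ^ 2 ≤ α ^ 2)
    (hα' : α ^ 2 ≤ ((99 : ℝ) / 100) ^ 2) (h1 : 1 < x) (h3 : x ≤ 3)
    (horbit : x * (x - 3) ^ 2 = 4 * α ^ 2) :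
    gksTrapping 1 α x < -(x ^ 3 / 10) := by
  -- localise `x`: `x < x₁ = 2.699062` and `x > 1.07`, by antitonicity of `x(x−3)²` on `[1,3]`
  have hx₁ : x < 1349531 / 500000 := by
    by_contra h
    push Not at h
    have hm := orbitFun_le_of_le (x := 1349531 / 500000) (y := x) (by norm_num) h h3
    nlinarith [hm, hα]
  have hx₀ : 107 / 100 < x := by
    by_contra h
    push Not at h
    have hm := orbitFun_le_of_le (x := x) (y := 107 / 100) h1.le h (by norm_num)
    nlinarith [hm, hα']
  have hc := exitCubic_neg hx₀.le hx₁.le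
  have h2 : x * (5 * x ^ 3 - 3 * x ^ 2 - 45 * x + 45) < 0 := mul_neg_of_pos_of_neg (by linarith) hc
  have key := gksTrapping_add_on_orbit (M := 1) (a := α) (c := x) (by simpa using horbit)
  simp only [gksTrapping] at key ⊢
  nlinarith [key, h2]

/-! ### The threshold, in Kerr units -/

/-- **The photon shell lies in the GKS trapping region for `|a| ≤ 0.2472 M`.** For `0 < M`,
`|a| ≤ 0.2472·M` and every radius `c` of the closed photon shell
`[r_ph⁺, r_ph⁻] = [photonOrbitRadius M (−|a|), photonOrbitRadius M |a|]` (the radii of Teo's spherical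
photon orbits, to which all trapped null geodesics of Kerr are asymptotic, GKS Remark 3.8.5):
`|𝒯(c)| ≤ c³/10`, i.e. `c ∈ {|𝒯|/r³ ≤ δ_trap}` with `δ_trap = 1/10` (GKS Def. 1.4.2: "This is the
region that contains all trapped null geodesics, for sufficiently small a/m" — here quantified).
[cite: GiorgiKlainermanSzeftel2022, Def. 1.4.2, Def. 6.1.9 and Remark 3.8.5] -/
theorem abs_gksTrapping_le_of_mem_photonShell {M a c : ℝ} (hM : 0 < M)
    (ha : |a| ≤ 2472 / 10000 * M) (h₁ : photonOrbitRadius M (-|a|) ≤ c)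
    (h₂ : c ≤ photonOrbitRadius M |a|) :
    |gksTrapping M a c| ≤ c ^ 3 / 10 := by
  have haM : |a| ≤ M := ha.trans (by nlinarith)
  have haM' : |a| < M := lt_of_le_of_lt ha (by nlinarith)
  have hp := photonCubic_nonpos_of_mem_photonShell hM haM h₁ h₂
  obtain ⟨hlo, -⟩ := photonOrbitRadius_neg_mem (x := -|a|) hM (by linarith) (by simp)
  have hlo' : M < c := hlo.trans_le h₁
  have hM0 : M ≠ 0 := hM.ne'
  -- normalise: `c = M x`, `a = M α`
  obtain ⟨x, rfl⟩ : ∃ x, c = M * x := ⟨c / M, by field_simp⟩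
  obtain ⟨α, rfl⟩ : ∃ α, a = M * α := ⟨a / M, by field_simp⟩
  have hM3 : 0 < M ^ 3 := pow_pos hM 3
  have h1x : 1 ≤ x := by nlinarith
  have hαabs : |α| ≤ 2472 / 10000 := by
    rw [abs_mul, abs_of_pos hM] at ha
    nlinarith [abs_nonneg α]
  have hα2 : α ^ 2 ≤ ((2472 : ℝ) / 10000) ^ 2 := by
    rw [← sq_abs]; exact pow_le_pow_left₀ (abs_nonneg α) hαabs 2
  have hshell : x * (x - 3) ^ 2 ≤ 4 * α ^ 2 := by
    have e : M * x * (M * x - 3 * M) ^ 2 - 4 * M * (M * α) ^ 2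
        = M ^ 3 * (x * (x - 3) ^ 2 - 4 * α ^ 2) := by ring
    rw [e] at hp
    nlinarith [hp, hM3]
  have hx0 : (539813 : ℝ) / 200000 ≤ x := by
    -- `x(x−3)² ≤ 4α² ≤ 4·0.2472² < x₀(x₀−3)²` and antitonicity on `[1,3]`; trivial if `x ≥ 3`
    by_contra h
    push Not at h
    have hm := orbitFun_le_of_le (x := x) (y := 539813 / 200000) h1x h.le (by norm_num)
    nlinarith [hm, hα2]
  have hlow := neg_le_gksTrapping_one hx0 hshell
  have hup := gksTrapping_one_le hα2 h1x hshell
  rw [gksTrapping_scale, abs_mul, abs_of_pos hM3]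
  have e2 : (M * x) ^ 3 / 10 = M ^ 3 * (x ^ 3 / 10) := by ring
  rw [e2]
  exact mul_le_mul_of_nonneg_left (abs_le.2 ⟨by linarith, hup⟩) hM3.le

/-- **Beyond `|a| = 0.2473 M` the prograde circular photon orbit leaves the GKS trapping region.**
For `0 < M` and `0.2473·M ≤ |a| ≤ 0.99·M`, the prograde photon radius
`r_ph⁺ = photonOrbitRadius M (−|a|)` — the constant radius of a trapped null geodesic of Kerr, the
prograde equatorial circular photon orbit (Bardeen–Press–Teukolsky 1972, (2.18)) — satisfies
`𝒯(r_ph⁺) < −(r_ph⁺)³/10`, hence `|𝒯(r_ph⁺)|/(r_ph⁺)³ > 1/10 = δ_trap`: the clause "contains all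
trapped null geodesics" of GKS Def. 1.4.2 fails. (For `|a|/M` above `≈ 0.9988` the prograde radius
re-enters the collar, other shell radii do not; the bound `0.99` keeps the statement elementary.)
[cite: GiorgiKlainermanSzeftel2022, Def. 1.4.2, Def. 6.1.9 and Remark 3.8.5] -/
theorem gksTrapping_photonOrbitRadius_neg_lt {M a : ℝ} (hM : 0 < M)
    (ha : 2473 / 10000 * M ≤ |a|) (ha' : |a| ≤ 99 / 100 * M) :
    gksTrapping M a (photonOrbitRadius M (-|a|)) < -(photonOrbitRadius M (-|a|) ^ 3 / 10) := by
  have haM : |a| < M := lt_of_le_of_lt ha' (by nlinarith)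
  obtain ⟨hlo, hhi⟩ := photonOrbitRadius_neg_mem (x := -|a|) hM (by linarith) (by simp)
  have hp := photonOrbit_p_eq_zero_of_abs_le (M := M) (x := -|a|) hM (by simpa using haM.le)
  have hM0 : M ≠ 0 := hM.ne'
  -- normalise: `a = M α`, `r_ph⁺ = M x`
  obtain ⟨α, rfl⟩ : ∃ α, a = M * α := ⟨a / M, by field_simp⟩
  obtain ⟨x, hx⟩ : ∃ x, photonOrbitRadius M (-|M * α|) = M * x :=
    ⟨photonOrbitRadius M (-|M * α|) / M, by field_simp⟩
  rw [hx] at hlo hhi hp ⊢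
  have hM3 : 0 < M ^ 3 := pow_pos hM 3
  have h1x : 1 < x := by nlinarith
  have h3x : x ≤ 3 := by nlinarith
  rw [abs_mul, abs_of_pos hM] at ha ha'
  have hαlo : 2473 / 10000 ≤ |α| := by nlinarith [abs_nonneg α]
  have hαhi : |α| ≤ 99 / 100 := by nlinarith [abs_nonneg α]
  have hα2 : ((2473 : ℝ) / 10000) ^ 2 ≤ α ^ 2 := by
    have h := pow_le_pow_left₀ (by norm_num) hαlo 2
    rwa [sq_abs] at h
  have hα2' : α ^ 2 ≤ ((99 : ℝ) / 100) ^ 2 := by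
    rw [← sq_abs]; exact pow_le_pow_left₀ (abs_nonneg α) hαhi 2
  have horbit : x * (x - 3) ^ 2 = 4 * α ^ 2 := by
    have e : M * x * (M * x - 3 * M) ^ 2 - 4 * (-(M * |α|)) ^ 2 * M
        = M ^ 3 * (x * (x - 3) ^ 2 - 4 * |α| ^ 2) := by ring
    rw [abs_mul, abs_of_pos hM, e] at hp
    have h0 := (mul_eq_zero.mp hp).resolve_left (pow_ne_zero 3 hM.ne')
    rw [sq_abs] at h0
    linarith
  have core := gksTrapping_one_lt_neg hα2 hα2' h1x h3x horbit
  rw [gksTrapping_scale]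
  have e2 : (M * x) ^ 3 / 10 = M ^ 3 * (x ^ 3 / 10) := by ring
  rw [e2, ← mul_neg]
  exact mul_lt_mul_of_pos_left core hM3

/-- **The threshold is bracketed**: combining the two theorems, the supremum of the `λ` for which
"`|a| ≤ λM` ⟹ photon shell ⊆ `{|𝒯| ≤ r³/10}`" holds lies in `[0.2472, 0.2473)`. Stated without
suprema: containment at `λ = 0.2472` and failure at `λ = 0.2473`, for every `M > 0`.
[cite: GiorgiKlainermanSzeftel2022, Def. 1.4.2] -/
theorem gksTrapping_threshold_bracket {M : ℝ} (hM : 0 < M) :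
    (∀ a c : ℝ, |a| ≤ 2472 / 10000 * M → photonOrbitRadius M (-|a|) ≤ c →
        c ≤ photonOrbitRadius M |a| → |gksTrapping M a c| ≤ c ^ 3 / 10) ∧
    (∀ a : ℝ, |a| = 2473 / 10000 * M →
        (photonOrbitRadius M (-|a|)) ^ 3 / 10 < |gksTrapping M a (photonOrbitRadius M (-|a|))|) := by
  refine ⟨fun a c ha h₁ h₂ => abs_gksTrapping_le_of_mem_photonShell hM ha h₁ h₂, fun a ha => ?_⟩
  have h := gksTrapping_photonOrbitRadius_neg_lt hM ha.ge (by rw [ha]; nlinarith)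
  have hR : 0 < photonOrbitRadius M (-|a|) := by
    have haM : |a| < M := by rw [ha]; nlinarith
    exact hM.trans (photonOrbitRadius_neg_mem (x := -|a|) hM (by linarith) (by simp)).1
  rw [abs_of_neg (h.trans (by have := pow_pos hR 3; linarith))]
  linarith

end Kerr

end Literature.Geometry.Lorentzian

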